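/-
Copyright (c) 2026. All rights reserved.
Released under Apache 2.0 license as described in the file LICENSE.
Authors: abc-iut cell, discharge seat abc-iut-w4-d095 (wave 4, gen 3).
-/
import Literature.AnabelianGeometry.AbsoluteAnabelian.LogFrobeniusCorollaries
import Literature.AnabelianGeometry.AbsoluteAnabelian.DiagramLifts
import HarnessLib

/-!
# [AbsTopIII] Corollary 5.5 (iii)/(iv) at the DIAGONAL setting: the `⊞`-observables exist and the typed log-wall `Cor55Incompatibility` FAILS — with `LogFrobeniusLogWallNonVacuity.lean`, FACT-LIST row F-0141 is INDEPENDENT of the interface `LogFrobeniusSetting`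

S. Mochizuki, *Topics in absolute anabelian geometry III: global reconstruction algorithms*,
J. Math. Sci. Univ. Tokyo 22 (2015) 939–1156 [MochizukiAbsTopIII2015]; locators `p.N` = pages of the
author's manuscript (`paper:url-5493eb38cbb7`): Def 3.5 (ii), (iii) pp. 75–76 (families of homotopies, observables,
cores), Def 5.4 (ii), (iv), (vi), (vii) pp. 125–128, Cor 5.5 (iii), (iv) p. 131.

PROOF companion of `LogFrobeniusCorollaries.lean` (abc-iut-L4-t3: `Cor55Observables`, `Cor55Incompatibility` = FACT-LIST
F-0141) and of this seat's `LogFrobeniusSettingNonVacuity.lean` (p423782) / `LogFrobeniusLogWallNonVacuity.lean` (p424770).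
Contents:

* `LogFrobeniusSetting.diagonal Vmod isArc C` — the DIAGONAL setting on a large category `C` as a NAMED construction
  (every row of `D•`/`D⊢` is `C`, every structure functor `𝟭 C`, every equivalence `refl`, every 2-cell an identity,
  `ι⊞_{v,ε}` the identification `Λ_ν ∘ 𝟭 = 𝟭`); it is the witness used anonymously in p423782.  DEGENERATE by design:
  a consistency/calibration device for the TYPED statements, with no arithmetic content.
* `DiagramOfCategories.strictFamily` — generic toolkit (Def 3.5 (ii)): on ANY diagram of categories, a saturated set of
  co-verticial pairs of paths whose path functors are EQUAL carries the family of homotopies "`eqToHom`" (the family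
  of strict commutations).
* `LogFrobeniusSetting.pathFunctor_extend_heq` — generic bookkeeping for ANY setting `L`: the path functors of the
  presentation `D•_{≤P} ∪ {x}` (`(L.subdiagram P).extend (L.obsExt P x)`) are those of `D•⊢` along the embedding
  `embExt P x` (heterogeneously).
* `LogFrobeniusSetting.diagonal_pathFunctor_eq` — in the diagonal setting any two co-verticial path functors of `D•⊢`
  coincide (every path functor is the composite `C ⥤ C` of identity functors); likewise on the presentations.
* `LogFrobeniusSetting.diagonal_cor55Observables` — the typed Cor 5.5 (iii) (`⊞`-half) HOLDS at the diagonal setting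
  (observable `S_log⊞_v` := strict commutations of the pairs of paths ending at `𝒩⊞_v`; its prescribed homotopies ARE
  the `ι⊞_{v,ε}` because both are `eqToHom`s).
* `LogFrobeniusSetting.diagonal_not_cor55Incompatibility` — the typed Cor 5.5 (iv), first sentence (`⊞`-half), FAILS at
  the diagonal setting: the strict-commutation core on `D•_{≤1} ∪ {□}`, the strict-commutation observables and the
  strict-commutation family of ALL co-verticial pairs of `D•⊢` are pairwise compatible.  Together with
  `LogFrobeniusSetting.exists_cor55Incompatibility` (p424770: the log-wall HOLDS at the zero-twisted diagonal setting)
  this is the kernel INDEPENDENCE of F-0141 from the interface: `Cor55Incompatibility` is neither provable nor refutable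
  from the typing of `LogFrobeniusSetting`, i.e. it is correctly carried as a NAMED HYPOTHESIS quoting print (the two
  halves live in two files because the other file's module is imported by neither: cite both theorems).

HONEST LABEL: calibration of typed statements only; the diagonal setting is not a model of any arithmetic object.
Refereed pre-IUT anabelian geometry; nothing here bears on [IUTchIII] Cor. 3.12; typed ≠ proved.
-/

set_option autoImplicit false

universe v u w

open CategoryTheory Quiver

namespace Literature.AnabelianGeometry.AbsoluteAnabelian

/-! ## Toolkit: the family of strict commutations (Def 3.5 (ii)) -/

namespace DiagramOfCategories

variable {V : Type w} [Quiver.{v} V] (D : DiagramOfCategories.{v, u, w} V)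

/-- Whiskering an `eqToHom` of functors on both sides is an `eqToHom`. [folklore] -/
private theorem whiskerLeft_whiskerRight_eqToHom {A B B' B'' : Type u} [Category.{v} A] [Category.{v} B]
    [Category.{v} B'] [Category.{v} B''] (R₁ : A ⥤ B) {F G : B ⥤ B'} (h : F = G) (R₂ : B' ⥤ B'') :
    Functor.whiskerLeft R₁ (Functor.whiskerRight (eqToHom h) R₂) =
      eqToHom (show R₁ ⋙ F ⋙ R₂ = R₁ ⋙ G ⋙ R₂ by rw [h]) := by
  subst h
  rw [eqToHom_refl, Functor.whiskerRight_id', Functor.whiskerLeft_id', eqToHom_refl]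

/-- **The family of strict commutations** (Def 3.5 (ii)): on a saturated set `T` of co-verticial pairs of paths whose
path functors are EQUAL, the homotopies `eqToHom` form a family of homotopies (identity on the diagonal, composition,
whiskering). [cite: MochizukiAbsTopIII2015, Definition 3.5 (ii) p.75] -/
def strictFamily (T : ∀ ⦃a b : V⦄, Path a b → Path a b → Prop) (hT : IsSaturated T)
    (hall : ∀ ⦃a b : V⦄ ⦃p q : Path a b⦄, T p q → D.pathFunctor p = D.pathFunctor q) : D.HomotopyFamily where
  E := T
  isSaturated := hT
  η := fun ⦃_ _ _ _⦄ h => eqToHom (hall h)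
  η_refl := fun ⦃_ _ _⦄ _ => eqToHom_refl _ _
  η_trans := fun ⦃_ _ _ _ _⦄ _ _ => (eqToHom_trans _ _).symm
  η_whisker := fun ⦃_ _ _ _ _ _⦄ h r₁ r₂ => by
    show eqToHom _ = eqToHom _ ≫ Functor.whiskerLeft _ (Functor.whiskerRight (eqToHom _) _) ≫ eqToHom _
    rw [whiskerLeft_whiskerRight_eqToHom]
    simp only [eqToHom_trans]

/-- The boundary set of the family of strict commutations is `T`. [cite: MochizukiAbsTopIII2015, Definition 3.5 (ii) p.75] -/
theorem strictFamily_E (T : ∀ ⦃a b : V⦄, Path a b → Path a b → Prop) (hT : IsSaturated T)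
    (hall : ∀ ⦃a b : V⦄ ⦃p q : Path a b⦄, T p q → D.pathFunctor p = D.pathFunctor q) {a b : V} (p q : Path a b) :
    (D.strictFamily T hT hall).E p q ↔ T p q := Iff.rfl

/-- Its homotopies are the `eqToHom`s. [cite: MochizukiAbsTopIII2015, Definition 3.5 (ii) p.75] -/
theorem strictFamily_η (T : ∀ ⦃a b : V⦄, Path a b → Path a b → Prop) (hT : IsSaturated T)
    (hall : ∀ ⦃a b : V⦄ ⦃p q : Path a b⦄, T p q → D.pathFunctor p = D.pathFunctor q) {a b : V} {p q : Path a b}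
    (h : (D.strictFamily T hT hall).E p q) : (D.strictFamily T hT hall).η h = eqToHom (hall h) := rfl

/-- In an extension shape WITHOUT telecore edges (an observable shape, Def 3.5 (iii)) the set of co-verticial pairs of
paths ENDING at the observation vertex is saturated (no path leaves `v_𝒮`).
[cite: MochizukiAbsTopIII2015, Definition 3.5 (iii) p.75] -/
theorem isSaturated_endsAt_obs (X : ExtShape.{v} V) (hX : ∀ a, IsEmpty (X.J a)) :
    IsSaturated (V := X.Vertex) (fun _ b _ _ => b = X.obs) where
  refl_left _ _ _ _ h := h
  refl_right _ _ _ _ h := h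
  trans _ _ _ _ _ h _ := h
  precomp _ _ _ _ _ h _ := h
  postcomp _ b c _ _ h r := by
    subst h
    have hout : ∀ w : X.Vertex, IsEmpty (X.obs ⟶ w) := fun w => by
      cases w with
      | base a => exact hX a
      | obs => exact (inferInstance : IsEmpty PEmpty)
    exact eq_of_path_of_isEmpty_hom hout r

end DiagramOfCategories

/-! ## Toolkit: `eqToHom` and composition under heterogeneous equality -/

section HEqLemmas

/-- Composition of functors respects heterogeneous equality over identifications of the categories (types and category
structures). [folklore] -/
private theorem heq_comp_of_heq {A B D A' B' D' : Type (u + 1)} {iA : Category.{u} A} {iB : Category.{u} B}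
    {iD : Category.{u} D} {iA' : Category.{u} A'} {iB' : Category.{u} B'} {iD' : Category.{u} D'}
    (hA : A = A') (hiA : HEq iA iA') (hB : B = B') (hiB : HEq iB iB') (hD : D = D') (hiD : HEq iD iD')
    {F : A ⥤ B} {F' : A' ⥤ B'} {G : B ⥤ D} {G' : B' ⥤ D'} (hF : HEq F F') (hG : HEq G G') :
    HEq (F ⋙ G) (F' ⋙ G') := by
  subst hA hB hD
  cases hiA; cases hiB; cases hiD; cases hF; cases hG
  rfl

/-- Identity functors respect heterogeneous equality over identifications of the categories. [folklore] -/
private theorem heq_id_of_eq {A A' : Type (u + 1)} {iA : Category.{u} A} {iA' : Category.{u} A'} (hA : A = A')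
    (hiA : HEq iA iA') : HEq (𝟭 A) (𝟭 A') := by
  subst hA; cases hiA; rfl

/-- Two `eqToHom`s between pairwise equal objects are heterogeneously equal. [folklore] -/
private theorem heq_eqToHom_eqToHom {C : Type*} [Category C] {x y x' y' : C} (hx : x = x') (hy : y = y')
    (e : x = y) (e' : x' = y') : HEq (eqToHom e) (eqToHom e') := by
  subst hx hy; rfl

/-- A chain of three `eqToHom`s is an `eqToHom` (stated with free endpoints so that it applies up to definitional
unfolding of the intermediate objects). [folklore] -/
private theorem eqToHom_eq_comp₃ {C : Type*} [Category C] {a b c d : C} (p : a = b) (q : b = c) (r : c = d)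
    (s : a = d) : eqToHom s = eqToHom p ≫ eqToHom q ≫ eqToHom r := by
  cases p; cases q; cases r; simp

end HEqLemmas

namespace LogFrobeniusSetting

variable {Vmod : Type u} {isArc : Vmod → Bool}

/-! ## Generic: path functors of the presentations `D•_{≤P} ∪ {x}` versus `D•⊢` -/

section Generic

variable (L : LogFrobeniusSetting Vmod isArc) (P : DVertex Vmod isArc → Prop) (x : DVertex Vmod isArc)

/-- The category of the presentation `D•_{≤P} ∪ {x}` at a vertex is the category of `D•⊢` at its image under the
embedding `embExt`. [cite: MochizukiAbsTopIII2015, Cor 5.5 p. 130] -/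
theorem obj_extend_eq (a : (obsShape P x).Vertex) :
    ((L.subdiagram P).extend (L.obsExt P x)).obj a = L.diagram.obj ((embExt P x).obj a) := by
  cases a <;> rfl

/-- … with the same category structure. [cite: MochizukiAbsTopIII2015, Cor 5.5 p. 130] -/
theorem cat_extend_heq (a : (obsShape P x).Vertex) :
    HEq (((L.subdiagram P).extend (L.obsExt P x)).cat a) (L.diagram.cat ((embExt P x).obj a)) := by
  cases a <;> exact HEq.rfl

/-- The functor of the presentation at an arrow is the functor of `D•⊢` at its image. [cite: MochizukiAbsTopIII2015, Cor 5.5 p. 130] -/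
theorem map_extend_heq {a b : (obsShape P x).Vertex} (e : a ⟶ b) :
    HEq (((L.subdiagram P).extend (L.obsExt P x)).map e) (L.diagram.map ((embExt P x).map e)) := by
  cases a with
  | base a =>
    cases b with
    | base b => exact HEq.rfl
    | obs => exact HEq.rfl
  | obs =>
    cases b with
    | base b => exact (PEmpty.elim e : False).elim
    | obs => exact (PEmpty.elim e : False).elim

/-- **The path functors of the presentation `D•_{≤P} ∪ {x}` are those of `D•⊢` along the embedding** (heterogeneously:
the categories agree vertex by vertex only after case analysis). [cite: MochizukiAbsTopIII2015, Definition 3.5 (i) p.75] -/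
theorem pathFunctor_extend_heq {a b : (obsShape P x).Vertex} (p : Path a b) :
    HEq (((L.subdiagram P).extend (L.obsExt P x)).pathFunctor p)
      (L.diagram.pathFunctor ((embExt P x).mapPath p)) := by
  induction p with
  | nil =>
    rw [DiagramOfCategories.pathFunctor_nil, Prefunctor.mapPath_nil, DiagramOfCategories.pathFunctor_nil]
    exact heq_id_of_eq (L.obj_extend_eq P x a) (L.cat_extend_heq P x a)
  | cons p e ih =>
    rw [DiagramOfCategories.pathFunctor_cons, Prefunctor.mapPath_cons, DiagramOfCategories.pathFunctor_cons]
    exact heq_comp_of_heq (L.obj_extend_eq P x _) (L.cat_extend_heq P x _) (L.obj_extend_eq P x _)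
      (L.cat_extend_heq P x _) (L.obj_extend_eq P x _) (L.cat_extend_heq P x _) ih (L.map_extend_heq P x e)

end Generic

/-! ## The diagonal setting -/

section Diagonal

variable (Vmod isArc)
variable (C : Type (u + 1)) [Category.{u} C]

/-- `Λ_ν ∘ F = F` for `log = 𝟭`. [cite: MochizukiAbsTopIII2015, Def 5.4 (vii) p. 128] -/
theorem frobeniusTwist_id_comp_eq {Y : Type*} [Category Y] (F : C ⥤ Y) (b : Bool) :
    frobeniusTwist (𝟭 C) b ⋙ F = F := by
  cases b <;> rfl

/-- **The DIAGONAL log-Frobenius setting on a large category `C`** (the witness of p423782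
`LogFrobeniusSetting.nonempty`, now named): every row of `D•` and of `D⊢` is `C`, every structure functor (`proj`,
`log•_{T,T}`, `𝒩⊞_v → 𝒩_v → ℰ•`, `λ⊞_{v,ν}`, mono-analyticizations, `ψ`) is `𝟭 C`, every equivalence (`κ_{An•}`,
`An• ≃ ℰ•`, `ℰ⊢ ≃ An⊢`) is `Equivalence.refl`, every 2-cell is an identity isomorphism, and `ι⊞_{v,ε}` is the
identification `Λ_{ν₁} ∘ 𝟭 = 𝟭`.  DEGENERATE by design (module docstring): a calibration device for the typed
statements over the interface, with no arithmetic content. [cite: MochizukiAbsTopIII2015, Def 5.4 (ii) p. 125] -/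
def diagonal : LogFrobeniusSetting Vmod isArc where
  X := C
  E := C
  proj := 𝟭 C
  log := 𝟭 C
  logIsoId := Iso.refl _
  logOver := Iso.refl _
  Nplus := fun _ => C
  N := fun _ => C
  forget := fun _ => 𝟭 C
  toE := fun _ => 𝟭 C
  lam := fun _ _ => 𝟭 C
  lamOver := fun _ _ => Iso.refl _
  lam_spaceLink_eq_postLog := fun _ => rfl
  iota := fun _ ν₁ _ _ => eqToHom (frobeniusTwist_id_comp_eq C (𝟭 C) ν₁.isPostLog)
  An := C
  κAn := CategoryTheory.Equivalence.refl
  φAn := 𝟭 C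
  φAn_isEquivalence := inferInstance
  ηAn := Iso.refl _
  κAn₂ := CategoryTheory.Equivalence.refl
  Emono := C
  monoAn := 𝟭 C
  NmonoPlus := fun _ => C
  Nmono := fun _ => C
  forgetMono := fun _ => 𝟭 C
  toEmono := fun _ => 𝟭 C
  monoNplus := fun _ => 𝟭 C
  monoN := fun _ => 𝟭 C
  monoHomotopy := fun _ => Iso.refl _
  AnMono := C
  κAnMono := CategoryTheory.Equivalence.refl
  ψAnMono := fun _ _ => 𝟭 C

/-- `log•_{T,T}` of the diagonal setting is `𝟭 C`. [cite: MochizukiAbsTopIII2015, Def 5.4 (ii) p. 125] -/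
@[simp] theorem diagonal_log : (diagonal Vmod isArc C).log = 𝟭 C := rfl

/-- `λ⊞_{v,ν}` of the diagonal setting is `𝟭 C`. [cite: MochizukiAbsTopIII2015, Def 5.4 (iv) p. 127] -/
@[simp] theorem diagonal_lam (v : Vmod) (ν : LogVertex (isArc v)) : (diagonal Vmod isArc C).lam v ν = 𝟭 C := rfl

/-- `ι⊞_{v,ε}` of the diagonal setting is the `eqToHom` of `Λ_{ν₁} ∘ 𝟭 = 𝟭`. [cite: MochizukiAbsTopIII2015, Def 5.4 (vii) p. 128] -/
theorem diagonal_iota (v : Vmod) {ν₁ ν₂ : LogVertex (isArc v)} (ε : LogEdge (isArc v) ν₁ ν₂) :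
    (diagonal Vmod isArc C).iota v ε = eqToHom (frobeniusTwist_id_comp_eq C (𝟭 C) ν₁.isPostLog) := rfl

/-- The (identity) functor from the category of `D•⊢` at a vertex of the diagonal setting to `C`.
[cite: MochizukiAbsTopIII2015, Cor 5.5 p. 129] -/
def diagonalOut : (a : DVertex Vmod isArc) → ((diagonal Vmod isArc C).diagram.obj a ⥤ C)
  | .row1 _ => 𝟭 C | .core => 𝟭 C | .nplus _ => 𝟭 C | .nv _ => 𝟭 C | .e5 => 𝟭 C | .an => 𝟭 C | .e7 => 𝟭 C
  | .nmonoPlus _ => 𝟭 C | .nmono _ => 𝟭 C | .emono5 => 𝟭 C | .anMono => 𝟭 C | .emono7 => 𝟭 C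

/-- The (identity) functor from `C` to the category of `D•⊢` at a vertex of the diagonal setting.
[cite: MochizukiAbsTopIII2015, Cor 5.5 p. 129] -/
def diagonalIn : (b : DVertex Vmod isArc) → (C ⥤ (diagonal Vmod isArc C).diagram.obj b)
  | .row1 _ => 𝟭 C | .core => 𝟭 C | .nplus _ => 𝟭 C | .nv _ => 𝟭 C | .e5 => 𝟭 C | .an => 𝟭 C | .e7 => 𝟭 C
  | .nmonoPlus _ => 𝟭 C | .nmono _ => 𝟭 C | .emono5 => 𝟭 C | .anMono => 𝟭 C | .emono7 => 𝟭 C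

/-- Every functor of `D•⊢` in the diagonal setting is "the identity": `𝒟_e` preceded by `C ⥤ 𝒟_a` is `C ⥤ 𝒟_b`.
[cite: MochizukiAbsTopIII2015, Cor 5.5 p. 129] -/
theorem diagonalIn_comp_map {a b : DVertex Vmod isArc} (e : a ⟶ b) :
    diagonalIn Vmod isArc C a ⋙ (diagonal Vmod isArc C).diagram.map e = diagonalIn Vmod isArc C b := by
  cases e <;> rfl

/-- **Every path functor of `D•⊢` in the diagonal setting is the composite `𝒟_a ⥤ C ⥤ 𝒟_b` of identity functors.**
[cite: MochizukiAbsTopIII2015, Definition 3.5 (i) p.75] -/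
theorem diagonal_pathFunctor_eq_out_in {a b : DVertex Vmod isArc} (p : Path a b) :
    (diagonal Vmod isArc C).diagram.pathFunctor p = diagonalOut Vmod isArc C a ⋙ diagonalIn Vmod isArc C b := by
  induction p with
  | nil =>
    rw [DiagramOfCategories.pathFunctor_nil]
    cases a <;> rfl
  | cons p e ih =>
    rw [DiagramOfCategories.pathFunctor_cons, ih, Functor.assoc, diagonalIn_comp_map]

/-- **In the diagonal setting any two co-verticial path functors of `D•⊢` coincide.**
[cite: MochizukiAbsTopIII2015, Definition 3.5 (i) p.75] -/
theorem diagonal_pathFunctor_eq {a b : DVertex Vmod isArc} (p q : Path a b) :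
    (diagonal Vmod isArc C).diagram.pathFunctor p = (diagonal Vmod isArc C).diagram.pathFunctor q := by
  rw [diagonal_pathFunctor_eq_out_in, diagonal_pathFunctor_eq_out_in]

/-- … and likewise on every presentation `D•_{≤P} ∪ {x}`. [cite: MochizukiAbsTopIII2015, Definition 3.5 (i) p.75] -/
theorem diagonal_extend_pathFunctor_eq (P : DVertex Vmod isArc → Prop) (x : DVertex Vmod isArc)
    {a b : (obsShape P x).Vertex} (p q : Path a b) :
    (((diagonal Vmod isArc C).subdiagram P).extend ((diagonal Vmod isArc C).obsExt P x)).pathFunctor p =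
      (((diagonal Vmod isArc C).subdiagram P).extend ((diagonal Vmod isArc C).obsExt P x)).pathFunctor q :=
  eq_of_heq <| ((diagonal Vmod isArc C).pathFunctor_extend_heq P x p).trans <|
    (heq_of_eq (diagonal_pathFunctor_eq Vmod isArc C _ _)).trans
      ((diagonal Vmod isArc C).pathFunctor_extend_heq P x q).symm

end Diagonal

/-! ## Cor 5.5 (iii) holds and Cor 5.5 (iv) (first sentence, `⊞`-half) fails at the diagonal setting -/

section Content

variable (Vmod isArc)
variable (C : Type (u + 1)) [Category.{u} C]

/-- The family of strict commutations of ALL co-verticial pairs of paths of `D•⊢` at the diagonal setting (the ambient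
family into which core and observables embed). [cite: MochizukiAbsTopIII2015, Definition 3.5 (ii) p.75] -/
def diagonalFamily : (diagonal Vmod isArc C).diagram.HomotopyFamily :=
  (diagonal Vmod isArc C).diagram.strictFamily covert isSymmSaturated_covert.toIsSaturated
    (fun _ _ p q _ => diagonal_pathFunctor_eq Vmod isArc C p q)

/-- The family of strict commutations of the pairs of paths ENDING at the observation vertex `x` on the presentation
`D•_{≤P} ∪ {x}` of the diagonal setting (used as the core on `D•_{≤1} ∪ {□}` and as the observable `S_log⊞_v` on
`D•_{≤2} ∪ {𝒩⊞_v}`). [cite: MochizukiAbsTopIII2015, Definition 3.5 (iii) p.75] -/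
def diagonalObsFamily (P : DVertex Vmod isArc → Prop) (x : DVertex Vmod isArc) :
    (((diagonal Vmod isArc C).subdiagram P).extend ((diagonal Vmod isArc C).obsExt P x)).HomotopyFamily :=
  DiagramOfCategories.strictFamily _ (fun _ b _ _ => b = (obsShape P x).obs)
    (DiagramOfCategories.isSaturated_endsAt_obs (obsShape P x)
      (fun _ => (inferInstance : IsEmpty PEmpty.{u + 1})))
    (fun _ _ p q _ => diagonal_extend_pathFunctor_eq Vmod isArc C P x p q)

/-- Every boundary path of `diagonalObsFamily P x` ends at the observation vertex.
[cite: MochizukiAbsTopIII2015, Definition 3.5 (iii) p.75] -/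
theorem diagonalObsFamily_terminal (P : DVertex Vmod isArc → Prop) (x : DVertex Vmod isArc) :
    ∀ ⦃a b : (obsShape P x).Vertex⦄ ⦃p q : Path a b⦄, (diagonalObsFamily Vmod isArc C P x).E p q →
      b = (obsShape P x).obs :=
  fun _ _ _ _ h => h

/-- **Compatibility**: the strict-commutation family on `D•_{≤P} ∪ {x}` embeds into the strict-commutation family of
`D•⊢` (Def 3.5 (ii) "compatible families", across the embedding `embExt`).
[cite: MochizukiAbsTopIII2015, Cor 5.5 (iv) p. 131] -/
theorem diagonalObsFamily_compatibleIn (P : DVertex Vmod isArc → Prop) (x : DVertex Vmod isArc) :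
    (diagonal Vmod isArc C).CompatibleIn (diagonalFamily Vmod isArc C) (diagonalObsFamily Vmod isArc C P x) := by
  intro a b p q h
  refine ⟨trivial, ?_⟩
  have hb : b = (obsShape P x).obs := h
  subst hb
  change HEq (eqToHom (diagonal_extend_pathFunctor_eq Vmod isArc C P x p q))
    (eqToHom (diagonal_pathFunctor_eq Vmod isArc C ((embExt P x).mapPath p) ((embExt P x).mapPath q)))
  cases a with
  | base a =>
    exact heq_eqToHom_eqToHom (eq_of_heq ((diagonal Vmod isArc C).pathFunctor_extend_heq P x p))
      (eq_of_heq ((diagonal Vmod isArc C).pathFunctor_extend_heq P x q)) _ _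
  | obs =>
    exact heq_eqToHom_eqToHom (eq_of_heq ((diagonal Vmod isArc C).pathFunctor_extend_heq P x p))
      (eq_of_heq ((diagonal Vmod isArc C).pathFunctor_extend_heq P x q)) _ _

/-- **The strict commutations make `□` a core of `D•_{≤1} ∪ {□}` at the diagonal setting** (Def 3.5 (iii): the boundary
set is the set of ALL co-verticial pairs ending at `□`, and every `𝒳_⋎` reaches `□` by `id_⋎`).
[cite: MochizukiAbsTopIII2015, Definition 3.5 (iii) p.76] -/
theorem diagonal_isCore_core :
    (DiagramOfCategories.Observable.mk (obsShape (DVertex.InFirstRows (isArc := isArc) 1) DVertex.core)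
      (fun _ => (inferInstance : IsEmpty PEmpty.{u + 1}))
      ((diagonal Vmod isArc C).obsExt (DVertex.InFirstRows 1) .core)
      (diagonalObsFamily Vmod isArc C (DVertex.InFirstRows 1) .core)
      (diagonalObsFamily_terminal Vmod isArc C (DVertex.InFirstRows 1) .core)).IsCore where
  boundary_all _ _ _ := rfl
  reaches_obs := fun ⟨w, hw⟩ => by
    cases w
    case row1 n =>
      exact ⟨Path.nil.cons (DEdge.toCore n :
        (obsShape (DVertex.InFirstRows (isArc := isArc) 1) DVertex.core).base ⟨.row1 n, hw⟩ ⟶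
          (obsShape (DVertex.InFirstRows (isArc := isArc) 1) DVertex.core).obs)⟩
    all_goals exact absurd hw (by simp [DVertex.InFirstRows, DVertex.IsHolomorphic, DVertex.row])

/-- **The strict commutations form the observable `S_log⊞_v` at the diagonal setting** (Cor 5.5 (iii), `⊞`-half, as typed
by `IsLogObservablePlus`): all boundary paths end at `𝒩⊞_v`, and the prescribed homotopies at the pairs
`([λ⊞_{ν₁}], [λ⊞_{ν₂}])` and `([λ⊞_{sl}]∘[id_⋎]∘[log], [λ⊞_{ν₂}]∘[id_{⋎+1}])` are the `ι⊞_{v,ε}` — both sides being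
`eqToHom`s. [cite: MochizukiAbsTopIII2015, Cor 5.5 (iii) p. 131] -/
theorem diagonal_isLogObservablePlus (v : Vmod) :
    (diagonal Vmod isArc C).IsLogObservablePlus v
      (diagonalObsFamily Vmod isArc C (DVertex.InFirstRows 2) (.nplus v)) := by
  refine ⟨fun _ _ _ _ h => h, ?_, ?_⟩
  · intro ν₁ ν₂ ε h₁ h₂
    refine ⟨rfl, fun X₀ => ?_⟩
    have hobj : (((diagonal Vmod isArc C).logDiagramPlus v).pathFunctor (lamPath v ν₁ h₁)).obj X₀ =
        (frobeniusTwist (diagonal Vmod isArc C).log ν₁.isPostLog ⋙ (diagonal Vmod isArc C).lam v ν₁).obj X₀ := by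
      rw [lamPath, DiagramOfCategories.pathFunctor_cons, DiagramOfCategories.pathFunctor_nil]
      exact (Functor.congr_obj (frobeniusTwist_id_comp_eq C (𝟭 C) ν₁.isPostLog) X₀).symm
    have hobj' : ((diagonal Vmod isArc C).lam v ν₂).obj X₀ =
        (((diagonal Vmod isArc C).logDiagramPlus v).pathFunctor (lamPath v ν₂ h₂)).obj X₀ := by
      rw [lamPath, DiagramOfCategories.pathFunctor_cons, DiagramOfCategories.pathFunctor_nil]
      rfl
    refine ⟨hobj, hobj', ?_⟩
    change (eqToHom (diagonal_extend_pathFunctor_eq Vmod isArc C _ _ (lamPath v ν₁ h₁) (lamPath v ν₂ h₂))).app X₀ =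
      eqToHom hobj ≫ (eqToHom (frobeniusTwist_id_comp_eq C (𝟭 C) ν₁.isPostLog)).app X₀ ≫ eqToHom hobj'
    simp only [eqToHom_app]
    exact eqToHom_eq_comp₃ _ _ _ _
  · intro ν₁ ν₂ ε h₁ h₂ hsl n
    refine ⟨rfl, fun X₀ => ?_⟩
    have hobj : (((diagonal Vmod isArc C).logDiagramPlus v).pathFunctor (postLogDomPath v n hsl)).obj X₀ =
        (frobeniusTwist (diagonal Vmod isArc C).log ν₁.isPostLog ⋙ (diagonal Vmod isArc C).lam v ν₁).obj X₀ := by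
      rw [postLogDomPath, DiagramOfCategories.pathFunctor_cons, DiagramOfCategories.pathFunctor_cons,
        DiagramOfCategories.pathFunctor_cons, DiagramOfCategories.pathFunctor_nil]
      exact (Functor.congr_obj (frobeniusTwist_id_comp_eq C (𝟭 C) ν₁.isPostLog) X₀).symm
    have hobj' : ((diagonal Vmod isArc C).lam v ν₂).obj X₀ =
        (((diagonal Vmod isArc C).logDiagramPlus v).pathFunctor (postLogCodPath v n ν₂ h₂)).obj X₀ := by
      rw [postLogCodPath, DiagramOfCategories.pathFunctor_cons, DiagramOfCategories.pathFunctor_cons,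
        DiagramOfCategories.pathFunctor_nil]
      rfl
    refine ⟨hobj, hobj', ?_⟩
    change (eqToHom (diagonal_extend_pathFunctor_eq Vmod isArc C _ _ (postLogDomPath v n hsl)
      (postLogCodPath v n ν₂ h₂))).app X₀ =
      eqToHom hobj ≫ (eqToHom (frobeniusTwist_id_comp_eq C (𝟭 C) ν₁.isPostLog)).app X₀ ≫ eqToHom hobj'
    simp only [eqToHom_app]
    exact eqToHom_eq_comp₃ _ _ _ _

/-- **Cor 5.5 (iii) (`⊞`-half) HOLDS at the diagonal setting**: every `S_log⊞_v` exists (strict commutations).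
[cite: MochizukiAbsTopIII2015, Cor 5.5 (iii) p. 131] -/
theorem diagonal_cor55Observables : (diagonal Vmod isArc C).Cor55Observables :=
  fun v => ⟨_, diagonal_isLogObservablePlus Vmod isArc C v⟩

/-- **Cor 5.5 (iv), first sentence (`⊞`-half) — the typed log-wall `Cor55Incompatibility`, FACT-LIST F-0141 — FAILS at
the diagonal setting**: the strict-commutation core of `D•_{≤2}` on `D•_{≤1}`, the strict-commutation observables
`S_log⊞_v` and the strict-commutation family of all co-verticial pairs of `D•⊢` are pairwise compatible.  With
`LogFrobeniusSetting.exists_cor55Incompatibility` (`LogFrobeniusLogWallNonVacuity.lean`, p424770: the typed log-wall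
HOLDS at the zero-twisted diagonal setting) this shows that F-0141 is INDEPENDENT of the interface `LogFrobeniusSetting`
— neither provable nor refutable from the typing; correctly a named hypothesis quoting print.  Calibration of typed
statements only (the diagonal setting is degenerate). [cite: MochizukiAbsTopIII2015, Cor 5.5 (iv) p. 131] -/
theorem diagonal_not_cor55Incompatibility : ¬ (diagonal Vmod isArc C).Cor55Incompatibility := fun h =>
  h ⟨diagonalObsFamily Vmod isArc C (DVertex.InFirstRows 1) .core,
    diagonalObsFamily_terminal Vmod isArc C (DVertex.InFirstRows 1) .core, diagonalFamily Vmod isArc C,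
    fun v => diagonalObsFamily Vmod isArc C (DVertex.InFirstRows 2) (.nplus v), diagonal_isCore_core Vmod isArc C,
    diagonalObsFamily_compatibleIn Vmod isArc C (DVertex.InFirstRows 1) .core,
    fun v => ⟨diagonal_isLogObservablePlus Vmod isArc C v,
      diagonalObsFamily_compatibleIn Vmod isArc C (DVertex.InFirstRows 2) (.nplus v)⟩⟩

/-- **Over every index set there is a setting at which the typed Cor 5.5 (iii) holds and the typed Cor 5.5 (iv) (first
sentence, `⊞`-half) fails** — the diagonal setting on any large category, e.g. `FundamentalExtension.{u}`.
[cite: MochizukiAbsTopIII2015, Cor 5.5 (iv) p. 131] -/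
theorem exists_cor55Observables_and_not_cor55Incompatibility (C : Type (u + 1)) [Category.{u} C] :
    ∃ L : LogFrobeniusSetting Vmod isArc, L.X = C ∧ L.Cor55Observables ∧ ¬ L.Cor55Incompatibility :=
  ⟨diagonal Vmod isArc C, rfl, diagonal_cor55Observables Vmod isArc C, diagonal_not_cor55Incompatibility Vmod isArc C⟩

end Content

end LogFrobeniusSetting

end Literature.AnabelianGeometry.AbsoluteAnabelian

-- build-enqueue re-land (comment only, no declaration changed): seat abc-iut-w4-d095 g3, 2026-08-26T08:02Z; the 05:57:48Z accept (p427401) was a STRANDED ACCEPT without a farm olean.
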